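/-
Copyright (c) 2026 the pub-hodgecm-mathlib formalisation cell (harness21).  Prover seat hodgecm-mathlib-K2Liu-p07 (g0),
Track B «K2-LIT» ∕ hLiu418 #184♮, unit U3c «LOCAL SIEGEL» of the K2_Liu road, file #7a: payment of the socket
`K2LiuCurveThetaSigsU3cLocalSiegel.sig_K2LiuSiegelWeilScalarEqCharacter` — THE KUDLA–WEIL EIGEN-SCALAR IS THE INDUCING
CHARACTER OF `I_v((1 − n)∕2, χ_v)`.  2026-09-03.
-/
import Literature.NumberTheory.K2Lit.DoubledUnitaryDegeneratePrincipalSeries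
import Literature.NumberTheory.GaloisRepresentations.HeckeCharacter
import Mathlib.Analysis.SpecialFunctions.Pow.Real   -- `Complex.ofReal_cpow`, `Real.sqrt_eq_rpow`
import Mathlib.Analysis.Real.Sqrt                   -- `Real.sqrt_prod`
import HarnessLib

/-!
# K2_Liu road (hLiu418 = stmt-HodgeConjecture-24832), unit U3c «LOCAL SIEGEL», file #7a:
# the Kudla–Weil eigen-scalar `(χ_v⁻¹(det_Δ p))⁻¹ · ∏_{w ∣ v} ‖det_Δ p_w‖^{1∕2}` equals
# `localSiegelCharacter χ_v ((1 − n)∕2) p`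

Cell `pub/hodgecm-mathlib` (D-0151), Track B (21-frontier RULING «PUSH BOTH» 2026-09-03, director req621∕req624,
LEAD F0P6-plan «M-154j»), socket module
`Summits/HodgeConjecture/HodgeConjecture/Cruxes/HLiu418/Lines/K2_Liu_CurveThetaSigs_U3c_LocalSiegel.lean`
(planner K2Liu-plan (g0), sha16 88d6ccafb49980df), socket **`sig_K2LiuSiegelWeilScalarEqCharacter`** (#7a, size S):
the NORMALISATION BRIDGE between the tree's Kudla–Weil eigen-law ★ `apply_zero_toRep_mul_localSplitting_eq_mul`
(eigen-scalar `(χ_v⁻¹(det_Δ p))⁻¹ · ∏_{w ∣ v} √‖det_Δ p_w‖`, [HarrisKudlaSweet1996 §1 (1.16)] with partner dimension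
`m = 1`) and the inducing character ★ `K2Lit.LocalSiegelDoubled.localSiegelCharacter χ_v s = χ_v(det_Δ ·)·|det_Δ ·|_v^{s + n∕2}`
of leaf D1 (★ `Literature/NumberTheory/K2Lit/DoubledUnitaryDegeneratePrincipalSeries`) at `s₁ = (1 − n)∕2`, i.e.
`s₁ + n∕2 = ½` (for `n = 2`, Liu's `J_0(s, ·)` on `U(2, 2)`: `s₁ = −½`).

THE MATHEMATICS (pure algebra, no hypothesis on `p`):
* `chiDet_inv` — ★ `chiDet χv h = ∏_{w ∣ v} (if det_Δ h_w is a unit then χ_w(det_Δ h_w) else 1)`, so replacing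
  the family `χ_w` by `χ_w⁻¹` (pointwise inverse of a homomorphism into the commutative group `ℂˣ`,
  Mathlib `MonoidHom.inv_apply`) inverts every factor, hence the product (`Finset.prod_inv_distrib`);
  `((χ_v⁻¹)(det_Δ p))⁻¹ = χ_v(det_Δ p)` by `inv_inv`;
* `ofReal_prod_sqrt_norm_detDelta` — `∏_w √‖det_Δ p_w‖ = √(∏_w ‖det_Δ p_w‖) = |det_Δ p|_v^{1∕2}` (Mathlib
  `Real.sqrt_prod`, `Real.sqrt_eq_rpow`), and for the non-negative real `|det_Δ p|_v` (★ `absDetDelta_nonneg`)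
  the real power `x^{1∕2}` cast to `ℂ` is the complex power `(x : ℂ)^{(1∕2 : ℂ)}` (Mathlib `Complex.ofReal_cpow`);
  the exponent `(1 − n)∕2 + n∕2` of `localSiegelCharacter` at `s₁ = (1 − n)∕2` is `1∕2` (`ring`).
* §2 **`siegelWeilScalarEqCharacter`** — `sig_K2LiuSiegelWeilScalarEqCharacter` TOKEN FOR TOKEN.
Junk-consistency (referee K2Liu-ref1 ∕ LEAD box): if some `det_Δ p_w` is not a unit both sides carry the factor
`1` for `χ` and `‖det_Δ p_w‖^{1∕2}` for the modulus — the identity holds for EVERY `p ∈ H(L⁺_v)`, as typed.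

HONEST LABEL: HC_CM is proved only modulo the 7 printed citations (2 remaining named inputs: hLiu418 =
stmt-HodgeConjecture-24832, h413 = stmt-HodgeConjecture-24833) until rung 0 closes; this file is a
`--supports stmt-HodgeConjecture-24832` helper (scaffold of the K2_Liu road, SIG TABLE
`Cruxes/HLiu418/Lines/K2_Liu_CurveThetaSigs.md` row #7a) and retires nothing by itself.

## References
* [HarrisKudlaSweet1996] M. Harris, S. S. Kudla, W. J. Sweet, *Theta dichotomy for unitary groups*,
  J. Amer. Math. Soc. 9 (1996) 941–1004, §1 (1.15)–(1.16).
* [Liu2021] Y. Liu, *Fourier–Jacobi cycles and arithmetic relative trace formula* ∕ App. B §B.3 p. 101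
  («the normalized induced representation»).
* [Kudla1994] S. S. Kudla, *Splitting metaplectic covers of dual reductive pairs*, Israel J. Math. 87 (1994), §3 Thm. 3.1.
-/

noncomputable section

-- the mandated namespace repeats the single-problem summit's segment (`HodgeConjecture.HodgeConjecture`)
set_option linter.dupNamespace false

open NumberField IsDedekindDomain
open Literature.NumberTheory.Automorphic Literature.NumberTheory.Automorphic.UnitaryGroup
open Literature.NumberTheory.GaloisRepresentations
open Literature.NumberTheory.GelbartRogawski1991.UnitaryDualPair.LocalSplitting
open Literature.NumberTheory.K2Lit.LocalSiegelDoubled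

namespace Summit.HodgeConjecture.HodgeConjecture.Cruxes.HLiu418.K2LiuSiegelWeilScalarEqCharacter

/-! ## §1  The two factors -/

section Factors

variable (F : Type) [Field F] [NumberField F] (E : Type) [Field E] [NumberField E] [Algebra F E]
  (c : E ≃ₐ[F] E) (v : HeightOneSpectrum (𝓞 F)) (n : ℕ) {JD : Matrix (Fin (n + n)) (Fin (n + n)) E}

/-- **`χ_v⁻¹(det_Δ h) = (χ_v(det_Δ h))⁻¹`**: the `det_Δ`-character ★ `chiDet` of the pointwise-inverse family
`w ↦ (χ_w)⁻¹` is the inverse of that of `χ_w` (factor by factor; the off-unit factors are `1 = 1⁻¹`).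
[cite: HarrisKudlaSweet1996, §1 (1.15)] -/
theorem chiDet_inv (χv : ∀ w : PlacesOver E v, (w.1.adicCompletion E)ˣ →* ℂˣ) (h : UnitaryGroup.localPi E c (n + n) JD v) :
    chiDet F E c v n (fun w => (χv w)⁻¹) h = (chiDet F E c v n χv h)⁻¹ := by
  unfold chiDet
  rw [← Finset.prod_inv_distrib]
  refine Finset.prod_congr rfl fun w _ => ?_
  split_ifs with hu
  · rfl
  · exact inv_one.symm

/-- **`∏_{w ∣ v} √‖det_Δ h_w‖ = |det_Δ h|_v^{1∕2}`** as complex numbers: the product of square roots is the square root of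
the product ★ `absDetDelta h = ∏_w ‖det_Δ h_w‖ ≥ 0`, and the real power `x^{1∕2}` of a non-negative real cast to `ℂ`
is the principal complex power `(x : ℂ)^{1∕2}` (the modulus factor `|det a|^{m∕2}`, `m = 1`, of the Weil
representation on the Siegel Levi). [cite: HarrisKudlaSweet1996, §1 (1.16)] -/
theorem ofReal_prod_sqrt_norm_detDelta (h : UnitaryGroup.localPi E c (n + n) JD v) :
    (((∏ w' : PlacesOver E v, Real.sqrt ‖detDelta F E c v n w' h‖ : ℝ)) : ℂ) =
      ((absDetDelta F E c v n h : ℂ) ^ (((1 / (2 : ℝ) : ℝ)) : ℂ)) := by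
  rw [← Complex.ofReal_cpow (absDetDelta_nonneg F E c v n h) (1 / 2), ← Real.sqrt_eq_rpow, absDetDelta,
    Real.sqrt_prod _ fun _ _ => norm_nonneg _]

end Factors

/-! ## §2  The head -/

/-- **PAYMENT OF `sig_K2LiuSiegelWeilScalarEqCharacter`** (socket #7a of unit U3c «LOCAL SIEGEL» of the K2_Liu road,
`Cruxes/HLiu418/Lines/K2_Liu_CurveThetaSigs_U3c_LocalSiegel.lean`, TOKEN FOR TOKEN).
**Normalisation bridge.** For a CM field `L ⊃ L⁺`, a finite place `v` of `L⁺`, any `n`, any doubled Gram matrix `J^𝔻`,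
a Hecke character `χ` of `L` and ANY `p ∈ H(L⁺_v)`: the Kudla–Weil eigen-scalar of ★ `apply_zero_toRep_mul_localSplitting_eq_mul`,
namely `(χ_v⁻¹(det_Δ p))⁻¹ · ∏_{w ∣ v} ‖det_Δ p_w‖^{1∕2}`, equals
`localSiegelCharacter χ_v s₁ p = χ_v(det_Δ p) · |det_Δ p|_v^{s₁ + n∕2}` at `s₁ = (1 − n)∕2` (`s₁ + n∕2 = ½`): §1 and `ring`
on the exponent.  So the Siegel–Weil section `h ↦ ω_v(h)Φ(0)` of the pair (`U(𝕍), U(W₁)`), `dim W₁ = 1`, is a section of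
`I_v((1 − n)∕2, χ_v)` in D1's (unitary) normalisation — for `n = 2` (Liu's `J_0(s, ·)` on `U(2,2)`): `s₁ = −½`.
[cite: HarrisKudlaSweet1996, §1 (1.16)] [cite: Liu2021, §B.3 p. 101] [cite: Kudla1994, §3 Thm. 3.1] -/
theorem siegelWeilScalarEqCharacter : ∀ (L : Type) [Field L] [NumberField L] [IsCMField L]
    (v : HeightOneSpectrum (𝓞 (maximalRealSubfield L))) (n : ℕ) {JD : Matrix (Fin (n + n)) (Fin (n + n)) L}
    (χ : HeckeCharacter L) (p : UnitaryGroup.localPi L (IsCMField.complexConj L) (n + n) JD v),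
    (((chiDet (maximalRealSubfield L) L (IsCMField.complexConj L) v n
          (fun w' : PlacesOver L v => (χ.localComponent w'.1)⁻¹) p)⁻¹ : ℂˣ) : ℂ) *
        ((∏ w' : PlacesOver L v,
          Real.sqrt ‖detDelta (maximalRealSubfield L) L (IsCMField.complexConj L) v n w' p‖ : ℝ) : ℂ) =
      localSiegelCharacter (maximalRealSubfield L) L (IsCMField.complexConj L) v n
        (fun w' : PlacesOver L v => χ.localComponent w'.1) ((1 - (n : ℂ)) / 2) p := by
  intro L _ _ _ v n JD χ p
  have hexp : (1 - (n : ℂ)) / 2 + (n : ℂ) / 2 = (((1 / (2 : ℝ) : ℝ)) : ℂ) := by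
    push_cast
    ring
  rw [chiDet_inv, inv_inv, ofReal_prod_sqrt_norm_detDelta, localSiegelCharacter, hexp]

end Summit.HodgeConjecture.HodgeConjecture.Cruxes.HLiu418.K2LiuSiegelWeilScalarEqCharacter

end
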